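import Summits.MatrixMultiplication.MatrixMultiplication.Theses.ObstructionDescent
import Summits.MatrixMultiplication.MatrixMultiplication.Theorems.ObstructionDescentOvershoot

/-!
# Closing the aside `OvershootFailsRowTwo` of route ObstructionDescent

Work item `stmt-MatrixMultiplication-28214` (route `ObstructionDescent`, decomp-mm lens 3, gen 24;
kind `aside`, banked context beneath the crux `NoPolyDegreeObstruction` = E, item 30889).

The statement: for every `δ > 0` there is `τ > 2` such that at infinitely many cells `(n, m)` of the
corner table of E (`n² ≤ m`, `n^τ ≤ m`) some polynomial, homogeneous of degree `m ^ 2` (row `c = 2`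
of E) and vanishing on all tensors of rank `≤ m` in the matrix-multiplication format
`(ℂⁿˣⁿ)^{⊗3}`, is non-zero at a tensor of rank `≤ n ^ (2 + δ)`.

Reading for E: the "overshoot" inference — from a border-rank bound `bR(⟨n,n,n⟩) ≤ n^{2+δ}` alone
to the vanishing of the degree-`≤ m²` equations of `σ_m` at `⟨n,n,n⟩` via
`I(σ_m)_{≤ m²} ⊆ I(σ_{n^{2+δ}})` — fails at row two, for every `δ > 0`, at infinitely many cells.

The mathematics is the route-independent kernel
`Theorems.ObstructionDescentOvershoot.overshoot_fails_rowTwo` (sub-format transport of secant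
equations + Kumar–Volk dimension counting); this file only matches it against the gate-written
declaration of the route file.

References: Kumar–Volk, *A polynomial degree bound on equations for non-rigid matrices and small
linear circuits* (2022), Thm 10 [KumarVolk2022]; Bläser, *Fast Matrix Multiplication* (2013),
Lemma 5.4 [Blaser2013]; Landsberg, *Geometry and Complexity Theory* (2017) §8.3.4
[LandsbergGCT2017].
-/

namespace Summit.MatrixMultiplication.MatrixMultiplication.Theorems.ObstructionDescentOvershootFails

set_option linter.dupNamespace false in
/-- **The aside `OvershootFailsRowTwo` holds** (item `stmt-MatrixMultiplication-28214`):
for every `δ > 0` there is `τ > 2` with, beyond every `n₀`, a cell `n₀ ≤ n`, `n * n ≤ m`,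
`n ^ τ ≤ m` and a degree-`m ^ 2` form vanishing on all rank-`≤ m` tensors of the format
`(Fin n × Fin n) × (Fin n × Fin n) × (Fin n × Fin n)` that is non-zero at some tensor of rank
`≤ n ^ (2 + δ)`.  Direct from `ObstructionDescentOvershoot.overshoot_fails_rowTwo`. -/
theorem overshootFailsRowTwo_holds :
    Summit.MatrixMultiplication.MatrixMultiplication.Theses.ObstructionDescent.OvershootFailsRowTwo :=
  fun δ hδ => ObstructionDescentOvershoot.overshoot_fails_rowTwo δ hδ

end Summit.MatrixMultiplication.MatrixMultiplication.Theorems.ObstructionDescentOvershootFails
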